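import Literature.NumberTheory.EllipticCurves.NewformPadicIntegralModel
import Literature.NumberTheory.EllipticCurves.NewformsCoeffFieldHolds
import Literature.NumberTheory.Automorphic.PadicIntermediateFieldUnitBall
import HarnessLib

/-!
# The characteristic ideal of a `Λ_𝒪`-module is principal, `𝒪` the ring of integers of a finite
# extension of `ℚ_p` inside `ℚ̄_p` — proofs (Washington §13.2; Emerton–Pollack–Weston 2006 §5.1)

Topic `Literature/NumberTheory/EllipticCurves`, namespace `Literature.NumberTheory.EllipticCurves`.

HONEST FRAMING (cell `b2b-bsdres`, home `run/shared/lean/b2b/bsd-rank1-residual/`): the cell deletes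
COMBINATION-SHAPED residual classes of the rank-`≤ 1` BSD formula from PUBLISHED theorems only and
types the rest; this is not "finishing BSD". This file PROVES — no named fact, nothing asserted —
the third displayed existence input (E3) of the cell's theorem
`Summits/BirchSwinnertonDyer/Rank1Residual/X11a/ChainDischarge.lean` (`X11a.forall_bsdp_of_facts`),
vendored by the `x11a` seat as the named fact `charIdeal_isPrincipal_weightK_member`
(file `WeightKMemberData.lean`): its body is the statement of
`charIdeal_isPrincipal_weightK_member_unconditional` below, word for word, so that the discharge
`theorem charIdeal_isPrincipal_weightK_member_holds : charIdeal_isPrincipal_weightK_member :=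
charIdeal_isPrincipal_weightK_member_unconditional` is a one-liner once that file is in the tree.

Washington, *Introduction to Cyclotomic Fields*, GTM 83, §13.2 (discussion after Thm. 13.12):
`Λ = ℤ_p⟦T⟧` is a unique factorisation domain, its height-one primes are principal, and the
characteristic ideal of a finitely generated torsion `Λ`-module — the product of the height-one
primes to the local lengths — is principal, generated by the characteristic power series; and
(§13.2, Remark; §13.4) "the theory … holds with `𝒪` in place of `ℤ_p`", `𝒪` the ring of integers
of a finite extension of `ℚ_p`. Emerton–Pollack–Weston, Invent. Math. 163 (2006) §5.1
(arXiv:math/0404484 p. 30): "`L_p^alg(f) ∈ Λ_𝒪` a generator of the characteristic power series of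
the `Λ_𝒪`-dual of `Sel(ℚ_∞, A_f)`".

The proof is the printed one, assembled from the tree and Mathlib:

* `padicCoeffIntegers_eq_unitBall`: the `x11a` vocabulary `padicCoeffIntegers S = {x ∈ ℚ_p(S) :
  |x|_p ≤ 1}` (`NewformPadicIntegralModel.lean`) IS the unit ball
  `PadicIntermediateField.unitBall p (ℚ_p(S))` of `Literature/NumberTheory/Automorphic/
  PadicIntermediateFieldUnitBall.lean` (same carrier: `Valued.v x = ‖x‖₊`);
* hence, for `ℚ_p(S)/ℚ_p` finite, `𝒪 = padicCoeffIntegers S` is a principal ideal domain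
  (`isPrincipalIdealRing_padicCoeffIntegers`; the tree's `isPrincipalIdealRing_unitBall`: the unit
  ball is the integral closure of `ℤ_p`, a local Dedekind domain — Neukirch, *Algebraic Number
  Theory*, Ch. II (4.8), (6.2); Serre, *Local Fields*, II §2 Prop. 3);
* hence `Λ_𝒪 = 𝒪⟦T⟧` is a unique factorisation domain (Mathlib: power series over a principal
  ideal domain), so every height-one prime of `Λ_𝒪` is principal
  (Mathlib `UniqueFactorizationMonoid.isPrincipal_of_height_eq_one`) and the characteristic ideal of
  ANY `Λ_𝒪`-module (the tree's `Module.charIdeal`, a `finprod` of powers of height-one primes; `⊤`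
  in the junk case) is principal (`Module.isPrincipal_charIdeal_of_uniqueFactorizationMonoid`,
  `isPrincipal_charIdeal_powerSeries_padicCoeffIntegers`) — exactly the tree's argument for
  `𝒪 = ℤ_p` (`charIdeal_isPrincipal_holds`, file `IwasawaAlgebra.lean`);
* `finiteDimensional_padicCoeffField_range_union_singleton`: `ℚ_p(ι(K), υ)` is finite over `ℚ_p`
  for `K/ℚ` finite, `ι : K → ℚ̄_p` a ring map and `υ ∈ ℚ̄_p` (algebraic); for a `Γ₀(M)`-newform
  `g`, `K_g = ℚ(a_n(g))` is a number field by the tree's THEOREM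
  `IsNewform0.finiteDimensional_coeffField_holds` (Shimura 1971, Thm. 3.48), whence
  `finiteDimensional_padicCoeffField_memberGenerators` for EPW's `K = ℚ_p(ι K_g, υ)`;
* `GreenbergSelmer.DualData.isPrincipal_charIdeal` and the (E3) instance
  `charIdeal_isPrincipal_weightK_member_unconditional` (its hypotheses `5 ≤ p`, multiplicative
  reduction, irreducibility, cyclotomic, finite generation, torsion are NOT used: principality holds
  for every `Λ_𝒪`-module; only `IsNewform0 g`, a conjunct of `IsOrdinaryMemberOf`, is used, to make
  `K/ℚ_p` finite).

## References

* L. C. Washington, *Introduction to Cyclotomic Fields*, GTM 83 (2nd ed. 1997), §13.2 (Thm. 13.12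
  and the discussion following it; Remark on `𝒪` in place of `ℤ_p`). [Washington1997]
* M. Emerton, R. Pollack, T. Weston, Invent. Math. 163 (2006), §3.1 (p. 17), §5.1 (p. 30).
  [EmertonPollackWeston2006]
* J. Neukirch, *Algebraic Number Theory* (1999), Ch. II (4.8), (6.2), §8. [NeukirchANT1999]
* J.-P. Serre, *Local Fields*, GTM 67 (1979), II §2 Prop. 3. [SerreLocalFields1979]
* G. Shimura, *Introduction to the arithmetic theory of automorphic functions* (1971), Thm. 3.48.
  [Shimura1971]
-/

noncomputable section

open scoped Classical MatrixGroups ModularForm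

open NumberField IsDedekindDomain Field CongruenceSubgroup
open Literature.NumberTheory.GaloisRepresentations
open Literature.NumberTheory.EllipticCurves.ModularForms

namespace Literature.NumberTheory.EllipticCurves

variable {p : ℕ} [Fact p.Prime]

/-! ### `padicCoeffIntegers S` is the unit ball of `ℚ_p(S)`; it is a principal ideal domain -/

/-- The `x11a` vocabulary `padicCoeffIntegers S = {x ∈ ℚ_p(S) : |x|_p ≤ 1}` coincides with the unit
ball `𝒪_{ℚ_p(S)} = ℚ_p(S) ∩ ℤ̄_p` of `PadicIntermediateFieldUnitBall` (the valuation of `ℚ̄_p` is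
`‖·‖₊`): both are EPW's "`𝒪` the ring of integers of `K`", the valuation ring of `K = ℚ_p(S)`
(Neukirch Ch. II (4.8)). [cite: EmertonPollackWeston2006, §3.1 (arXiv:math/0404484 p. 17)]
[cite: NeukirchANT1999, Ch. II (4.8)] -/
theorem padicCoeffIntegers_eq_unitBall (S : Set (PadicAlgCl p)) :
    padicCoeffIntegers S =
      Literature.NumberTheory.Automorphic.PadicIntermediateField.unitBall p (padicCoeffField S) := by
  ext x
  rw [mem_padicCoeffIntegers_iff,
    Literature.NumberTheory.Automorphic.PadicIntermediateField.mem_unitBall_iff,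
    PadicAlgCl.valuation_def, ← NNReal.coe_le_coe, coe_nnnorm, NNReal.coe_one]

/-- **`𝒪 = {x ∈ K : |x|_p ≤ 1}` is a principal ideal domain for `K = ℚ_p(S)` finite over `ℚ_p`**
(the ring of integers of a finite extension of `ℚ_p`: the integral closure of `ℤ_p`, a local
Dedekind domain, i.e. a discrete valuation ring — Neukirch Ch. II (4.8), (6.2); Serre, *Local
Fields*, II §2 Prop. 3; the tree's `PadicIntermediateField.isPrincipalIdealRing_unitBall`).
[cite: NeukirchANT1999, Ch. II (4.8) and (6.2)] [cite: SerreLocalFields1979, II §2 Prop. 3] -/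
theorem isPrincipalIdealRing_padicCoeffIntegers (S : Set (PadicAlgCl p))
    [FiniteDimensional ℚ_[p] (padicCoeffField S)] :
    IsPrincipalIdealRing (padicCoeffIntegers S) := by
  rw [padicCoeffIntegers_eq_unitBall]
  exact Literature.NumberTheory.Automorphic.PadicIntermediateField.isPrincipalIdealRing_unitBall p _

/-- `𝒪` is local (the non-units are `{|x|_p < 1}`; the tree's `isLocalRing_unitBall`).
[cite: NeukirchANT1999, Ch. II (4.8)] -/
theorem isLocalRing_padicCoeffIntegers (S : Set (PadicAlgCl p)) :
    IsLocalRing (padicCoeffIntegers S) := by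
  rw [padicCoeffIntegers_eq_unitBall]
  infer_instance

/-- `𝒪` is a Dedekind domain for `ℚ_p(S)/ℚ_p` finite (integral closure of `ℤ_p` in a finite
extension; the tree's `isDedekindDomain_unitBall`). [cite: NeukirchANT1999, Ch. I (8.1), Ch. II §8] -/
theorem isDedekindDomain_padicCoeffIntegers (S : Set (PadicAlgCl p))
    [FiniteDimensional ℚ_[p] (padicCoeffField S)] :
    IsDedekindDomain (padicCoeffIntegers S) := by
  rw [padicCoeffIntegers_eq_unitBall]
  infer_instance

/-! ### Finiteness of EPW's `K = ℚ_p(ι K_g, υ)` over `ℚ_p` -/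

/-- For a field `K` finite over `ℚ`, a ring map `ι : K → ℚ̄_p` and any `υ ∈ ℚ̄_p`, the field
`ℚ_p(ι(K), υ) ⊆ ℚ̄_p` is finite over `ℚ_p`: it is contained in (indeed equals) `ℚ_p(ι(b_1), …,
ι(b_n), υ)` for a `ℚ`-basis `(b_i)` of `K`, finitely many algebraic generators — EPW §3.1: "`K` the
finite extension of `ℚ_p` generated by the Fourier coefficients of `f`".
[cite: EmertonPollackWeston2006, §3.1 (arXiv:math/0404484 p. 17)] -/
theorem finiteDimensional_padicCoeffField_range_union_singleton {K : Type*} [Field K] [Algebra ℚ K]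
    [FiniteDimensional ℚ K] (ι : K →+* PadicAlgCl p) (υ : PadicAlgCl p) :
    FiniteDimensional ℚ_[p] (padicCoeffField (Set.range ι ∪ {υ})) := by
  classical
  let b := Module.finBasis ℚ K
  let T : Set (PadicAlgCl p) := Set.range (fun i ↦ ι (b i)) ∪ {υ}
  haveI : Finite T := ((Set.finite_range _).union (Set.finite_singleton υ)).to_subtype
  have hT : FiniteDimensional ℚ_[p] (IntermediateField.adjoin ℚ_[p] T) :=
    IntermediateField.finiteDimensional_adjoin fun x _ ↦ Algebra.IsIntegral.isIntegral x
  have hle : padicCoeffField (Set.range ι ∪ {υ}) ≤ IntermediateField.adjoin ℚ_[p] T := by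
    rw [IntermediateField.adjoin_le_iff]
    rintro x (⟨y, rfl⟩ | hx)
    · rw [← b.sum_repr y, map_sum]
      refine sum_mem fun i _ ↦ ?_
      rw [map_rat_smul, Rat.smul_def]
      exact mul_mem (SubfieldClass.ratCast_mem _ _)
        (IntermediateField.subset_adjoin ℚ_[p] T (Or.inl ⟨i, rfl⟩))
    · exact IntermediateField.subset_adjoin ℚ_[p] T (Or.inr hx)
  exact FiniteDimensional.of_injective (IntermediateField.inclusion hle).toLinearMap
    (IntermediateField.inclusion_injective hle)

/-- **EPW's `K = ℚ_p(ι K_g, υ)` is a finite extension of `ℚ_p`** for a newform `g ∈ S_k(Γ₀(M))`,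
`ι : K_g → ℚ̄_p`, `υ ∈ ℚ̄_p`: `K_g = ℚ(a_n(g))` is a number field (Shimura 1971, Thm. 3.48 — the
tree's THEOREM `IsNewform0.finiteDimensional_coeffField_holds`). EPW §3.1: "`K` the finite
extension of `ℚ_p` generated by the Fourier coefficients of `f`".
[cite: EmertonPollackWeston2006, §3.1 (arXiv:math/0404484 p. 17)] [cite: Shimura1971, Thm. 3.48] -/
theorem finiteDimensional_padicCoeffField_memberGenerators {M : ℕ} [NeZero M] {k : ℤ}
    {g : CuspForm (Gamma0 M) k} (hg : IsNewform0 g) (ι : coeffField g →+* PadicAlgCl p)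
    (υ : PadicAlgCl p) :
    FiniteDimensional ℚ_[p] (padicCoeffField (memberGenerators g ι υ)) := by
  haveI : FiniteDimensional ℚ (coeffField g) := IsNewform0.finiteDimensional_coeffField_holds hg
  exact finiteDimensional_padicCoeffField_range_union_singleton ι υ

/-! ### Principality of characteristic ideals over a unique factorisation domain and over `Λ_𝒪` -/

/-- **Over a unique factorisation domain every characteristic ideal is principal**: each height-one
prime is principal (Mathlib `UniqueFactorizationMonoid.isPrincipal_of_height_eq_one`), hence so is
each of its powers and their (finite, or junk-value `⊤`) product `Module.charIdeal R M`
(Washington §13.2, discussion after Thm. 13.12, for `R = Λ`; the tree's `charIdeal_isPrincipal_holds`).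
[cite: Washington1997, §13.2 (after Thm. 13.12)] -/
theorem Module.isPrincipal_charIdeal_of_uniqueFactorizationMonoid (R : Type*) [CommRing R]
    [IsDomain R] [UniqueFactorizationMonoid R] (M : Type*) [AddCommGroup M] [_root_.Module R M] :
    (Module.charIdeal R M).IsPrincipal := by
  unfold Module.charIdeal
  rw [← Ideal.mem_isPrincipalSubmonoid_iff]
  refine finprod_mem_induction (· ∈ Ideal.isPrincipalSubmonoid R)
    (Submonoid.one_mem _) (fun _ _ hx hy ↦ Submonoid.mul_mem _ hx hy) ?_
  intro 𝔭 h𝔭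
  refine Submonoid.pow_mem _ ?_ _
  obtain ⟨x, hx⟩ := UniqueFactorizationMonoid.isPrincipal_of_height_eq_one h𝔭
  rw [hx]
  exact Ideal.span_singleton_mem_isPrincipalSubmonoid x

/-- **The characteristic ideal of any `Λ_𝒪 = 𝒪⟦T⟧`-module is principal**, `𝒪 = {|x|_p ≤ 1} ⊆ K`
the ring of integers of a finite extension `K = ℚ_p(S)` of `ℚ_p` inside `ℚ̄_p`: `𝒪` is a principal
ideal domain, so `𝒪⟦T⟧` is a unique factorisation domain (Weierstrass preparation; Mathlib's
instance for power series over a principal ideal domain) — Washington §13.2 with the Remark that the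
theory holds for `𝒪` in place of `ℤ_p`; EPW §5.1 ("a generator of the characteristic power series of
the `Λ_𝒪`-dual"). [cite: Washington1997, §13.2 (Thm. 13.12 ff. and the Remark on 𝒪)]
[cite: EmertonPollackWeston2006, §5.1 (arXiv:math/0404484 p. 30)] -/
theorem isPrincipal_charIdeal_powerSeries_padicCoeffIntegers (S : Set (PadicAlgCl p))
    [FiniteDimensional ℚ_[p] (padicCoeffField S)] (M : Type*) [AddCommGroup M]
    [_root_.Module (PowerSeries (padicCoeffIntegers S)) M] :
    (Module.charIdeal (PowerSeries (padicCoeffIntegers S)) M).IsPrincipal := by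
  haveI : IsPrincipalIdealRing (padicCoeffIntegers S) := isPrincipalIdealRing_padicCoeffIntegers S
  exact Module.isPrincipal_charIdeal_of_uniqueFactorizationMonoid _ M

/-- **The characteristic ideal of the `Λ_𝒪`-dual of Greenberg's Selmer group is principal** — for
any framed representation `ρ : Γ_K → GL_n(𝒪)` over `𝒪 = 𝒪_{ℚ_p(S)}`, `ℚ_p(S)/ℚ_p` finite, any
plus-parts, any `ℤ_p`-extension and any dual datum `D` (no finiteness or torsion hypothesis on `D.X`
is needed for principality). EPW §5.1: `L_p^alg(f)` "a generator of the characteristic power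
series of the `Λ_𝒪`-dual of `Sel(ℚ_∞, A_f)`". [cite: EmertonPollackWeston2006, §5.1 (arXiv:math/0404484 p. 30)]
[cite: Washington1997, §13.2 (Thm. 13.12 ff. and the Remark on 𝒪)] -/
theorem GreenbergSelmer.DualData.isPrincipal_charIdeal {K : Type} [Field K] [NumberField K]
    (S : Set (PadicAlgCl p)) [FiniteDimensional ℚ_[p] (padicCoeffField S)] {n : ℕ}
    {κ : ZpExtension K p} {γ : absoluteGaloisGroup K}
    {ρ : FramedGaloisRep K (padicCoeffIntegers S) n}
    {P : ∀ v : HeightOneSpectrum (𝓞 K), ((p : ℕ) : 𝓞 K) ∈ v.asIdeal → GreenbergSelmer.PlusPart ρ v}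
    (D : GreenbergSelmer.DualData (padicCoeffField S) κ γ ρ P) :
    (D.charIdeal).IsPrincipal :=
  isPrincipal_charIdeal_powerSeries_padicCoeffIntegers S D.X

/-- **(E3) of the `X11a` chain, PROVED: the characteristic ideal of the `Λ_𝒪`-dual of
`Sel(ℚ_∞, A_g)` for a good-ordinary weight-`k` member `(g, ι)` of the Hida family of `E[p]` is
principal** — the body of the `x11a` seat's named fact `charIdeal_isPrincipal_weightK_member`
(`WeightKMemberData.lean`: Washington §13.2 Thm. 13.12 with the Remark on `𝒪`; EPW §5.1), word for
word, as a theorem. Of its hypotheses only `IsNewform0 g` (inside `IsOrdinaryMemberOf`) is used, to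
make `ℚ_p(ι K_g, υ)` finite over `ℚ_p`; principality then holds for every `Λ_𝒪`-module.
[cite: Washington1997, §13.2 (Thm. 13.12 and the Remark on 𝒪)]
[cite: EmertonPollackWeston2006, §5.1 (arXiv:math/0404484 p. 30)] -/
theorem charIdeal_isPrincipal_weightK_member_unconditional :
    ∀ (W : WeierstrassCurve ℚ) [W.IsElliptic] [W.IsGloballyMinimal] (p : ℕ) [Fact p.Prime],
      5 ≤ p → W.HasMultiplicativeReductionAtPrime p → W.HasIrreducibleModPGaloisRep p →
      ∀ [NeZero (W.conductorNorm ℤ / p)] {k : ℤ} (g : CuspForm (Gamma0 (W.conductorNorm ℤ / p)) k)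
        (ι : coeffField g →+* PadicAlgCl p), IsOrdinaryMemberOf W p g ι →
      ∀ (𝔇 : OrdinaryPadicData g p ι) (κ : ZpExtension ℚ p) (γ : Field.absoluteGaloisGroup ℚ),
        κ.IsCyclotomic → κ.IsTopGenerator γ →
      ∀ (D : GreenbergSelmer.DualData (padicCoeffField (memberGenerators g ι 𝔇.υ)) κ γ 𝔇.ρ 𝔇.plus),
        Module.Finite (PowerSeries (padicCoeffIntegers (memberGenerators g ι 𝔇.υ))) D.X →
        Module.IsTorsion (PowerSeries (padicCoeffIntegers (memberGenerators g ι 𝔇.υ))) D.X →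
        (D.charIdeal).IsPrincipal := by
  intro W _ _ p _ _ _ _ _ k g ι hmem 𝔇 κ γ _ _ D _ _
  haveI : FiniteDimensional ℚ_[p] (padicCoeffField (memberGenerators g ι 𝔇.υ)) :=
    finiteDimensional_padicCoeffField_memberGenerators hmem.2.2.1 ι 𝔇.υ
  exact GreenbergSelmer.DualData.isPrincipal_charIdeal (memberGenerators g ι 𝔇.υ) D

end Literature.NumberTheory.EllipticCurves

end
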